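import Literature.AnabelianGeometry.EtaleTheta.SettingModelChiThetaKummerInput
import Literature.AnabelianGeometry.EtaleTheta.SettingModelTateKummerData
import HarnessLib

/-!
# [EtTh] Prop. 1.4 (iii), Kummer side, at the STAGE-2 (Tate-sheared) χ-model `ThetaSetting.modelχq p i j`:
# genuine theta-Kummer input + `ConstCompat` + `Prop14iiiKummer` at the named datum `kummerDataχq`
# (proof-only; NV census tokens, stage-2 twin of `SettingModelChiThetaKummerInput.lean`)

Mochizuki, *The étale theta function and its Frobenioid-theoretic manifestations*, Publ. RIMS **45**
(2009) [EtTh], §1, Prop. 1.3 p. 21, Prop. 1.4 (iii) p. 22 ("the set of 'Kummer classes' … associated to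
the `O^×_K̈`-multiples of `Θ̈` … is precisely the set `O^×_K̈ · η̈^Θ`")
[cite: MochizukiEtTh2009, Prop 1.4 (iii) p.22].

Layer L2 of the abc-iut cell, seat abc-iut-w5-d125 (gen 6), NV-L2 row «ThetaKummerInput GENUINE +
ConstCompat + Prop14iiiKummer at the R78 models», stage-2 half: the R78 cluster's stage-2 model
`ThetaSetting.modelχq p i j hj` (abc-iut-L2-t5, F5q; generic Kummer exponents `(i, j)`, `j` even) carries
the Kummer core `SettingModel.kummerCoreχq` / named Kummer datum `kummerDataχq` (abc-iut-w5-d171, F6q,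
`SettingModelTateKummerData.lean`) and satisfies the guard `IsEtThOrigin` (`ThetaSetting.modelχq_isEtThOrigin`,
`SettingModelTateTheta.lean`). PROOF-ONLY companion (no `def`, no instance, no new named fact); nothing of
the cited files is edited or restated — every result is the generic
`ThetaSetting.KummerCore.exists_thetaKummerInput_etaleThetaData_prop14iii(_ne_one)` /
`exists_thetaKummerInput_bijective_ne_one` (this seat) instantiated BY NAME at `kummerCoreχq p i j hj`, plus
the negative half `KummerData.exists_thetaKummerInput_not_constCompat` (abc-iut-f-117 lineage).

RESULTS (kernel): `kummerDataχq_exists_thetaKummerInput_constCompat` (bijective coefficients, `ConstCompat`,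
`κΘ̈ ≠ 1`), `kummerDataχq_constCompat_independent` (F-0618 instance form at the named stage-2 datum: BOTH
truth values witnessed), `kummerDataχq_exists_prop14iiiKummer_genuine` (F-0589 instance form MODEL-WITNESSED
with genuine `κΘ̈` at stage 2), `modelχq_isEtThOrigin_and_prop14iiiKummer_genuine` (under the guard). So the
token «ThetaKummerInput GENUINE + ConstCompat + Prop14iiiKummer» now holds at ALL THREE χ-models of the R78
cluster (`modelχ`, `modelχ'`, `modelχq`); at the untwisted root `ThetaSetting.model p` it is VACUOUS-BY-
EMPTINESS (`model_isEmpty_kummerData`, abc-iut-w5-d171) and every input there has `κΘ̈ = 1`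
(`ThetaKummerInput.kummerTheta_eq_one_model`, abc-iut-w5-d047).

HONEST FRAMING: semi-synthetic model — consistency / non-vacuity evidence for the typed [EtTh] §1 interface
only; the `½`-coefficient groups of the `EtaleThetaData` used are the honest-degenerate ones of
`etaleThetaDataOfClass` (abc-iut-L2-t6); nothing of [EtTh] is asserted; typed ≠ proved; no side is taken
on [IUTchIII] Cor. 3.12.
-/

noncomputable section

namespace Literature.AnabelianGeometry.EtaleTheta

open Literature.AnabelianGeometry.SemiGraphs

namespace SettingModel

variable (p : ℕ) [Fact p.Prime] (i j : ℤ) (hj : Even j)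

/-- **At the named stage-2 datum `kummerDataχq p i j hj`**: a theta-Kummer input with BIJECTIVE coefficients
`Λ(ℚ̄_p^×) ≅ Δ_Θ(modelχq)`, `ConstCompat (kummerDataχq p i j hj)`, and non-trivial `κΘ̈` EXISTS (the
pull-back action instance `T.instAction` is supplied by `letI`, as in the stage-1 file).
[cite: MochizukiEtTh2009, Prop 1.4 (iii) p.22] -/
theorem kummerDataχq_exists_thetaKummerInput_constCompat :
    ∃ T : (ThetaSetting.modelχq p i j hj).ThetaKummerInput,
      (letI := T.instAction; Function.Bijective T.coeff.hom) ∧ T.ConstCompat (kummerDataχq p i j hj) ∧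
        T.kummerTheta ≠ 1 :=
  (kummerCoreχq p i j hj).exists_thetaKummerInput_bijective_ne_one

/-- **F-0618 `ConstCompat` at the named stage-2 datum: BOTH truth values witnessed** (census token
«ConstCompat@kummerDataχq: INDEPENDENT»). [cite: MochizukiEtTh2009, Prop 1.3 p.21] -/
theorem kummerDataχq_constCompat_independent :
    (∃ T : (ThetaSetting.modelχq p i j hj).ThetaKummerInput,
        (letI := T.instAction; Function.Bijective T.coeff.hom) ∧ T.ConstCompat (kummerDataχq p i j hj)) ∧
      ∃ T : (ThetaSetting.modelχq p i j hj).ThetaKummerInput, ¬ T.ConstCompat (kummerDataχq p i j hj) := by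
  obtain ⟨T, hb, hCC, -⟩ := kummerDataχq_exists_thetaKummerInput_constCompat p i j hj
  exact ⟨⟨T, hb, hCC⟩, (kummerDataχq p i j hj).exists_thetaKummerInput_not_constCompat⟩

/-- **Prop. 1.4 (iii), Kummer side, MODEL-WITNESSED with genuine coefficients at STAGE 2**: over
`kummerDataχq p i j hj` there are `T` (bijective coefficients, `ConstCompat`) and `E : EtaleThetaData` with
`E.toKummerData = kummerDataχq p i j hj`, `η̈^Θ = κΘ̈ ≠ 1`, `Prop14iiiKummer E κΘ̈`, and the theta classes
`O^×_K̈ · η̈^Θ` equal to the Kummer classes of the `O^×_K̈`-multiples of `Θ̈`.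
[cite: MochizukiEtTh2009, Prop 1.4 (iii) p.22] -/
theorem kummerDataχq_exists_prop14iiiKummer_genuine :
    ∃ (T : (ThetaSetting.modelχq p i j hj).ThetaKummerInput)
      (E : (ThetaSetting.modelχq p i j hj).EtaleThetaData),
      (letI := T.instAction; Function.Bijective T.coeff.hom) ∧ E.toKummerData = kummerDataχq p i j hj ∧
      T.ConstCompat (kummerDataχq p i j hj) ∧ E.etaDd = T.kummerTheta ∧ T.kummerTheta ≠ 1 ∧
      ThetaSetting.Prop14iiiKummer E T.kummerTheta ∧
      E.thetaClasses =
        {x | ∃ c ∈ (ThetaSetting.modelχq p i j hj).unitsOKdd, x = T.kummerConstMulTheta c} := by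
  obtain ⟨T, E, hb, hE, hCC, hη, hne, h14, hcl⟩ :=
    (kummerCoreχq p i j hj).exists_thetaKummerInput_etaleThetaData_prop14iii_ne_one
  exact ⟨T, E, hb, hE, hCC, hη, hne, h14, hcl⟩

/-- The stage-2 model also satisfies the guard: `IsEtThOrigin ∧` (genuine Prop. 1.4 (iii) Kummer-side
witness) at `modelχq p i j hj`. [cite: MochizukiEtTh2009, Prop 1.4 (iii) p.22] -/
theorem modelχq_isEtThOrigin_and_prop14iiiKummer_genuine :
    (ThetaSetting.modelχq p i j hj).IsEtThOrigin ∧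
      ∃ (T : (ThetaSetting.modelχq p i j hj).ThetaKummerInput)
        (E : (ThetaSetting.modelχq p i j hj).EtaleThetaData),
        (letI := T.instAction; Function.Bijective T.coeff.hom) ∧ T.ConstCompat E.toKummerData ∧
        E.etaDd = T.kummerTheta ∧ T.kummerTheta ≠ 1 ∧ ThetaSetting.Prop14iiiKummer E T.kummerTheta := by
  obtain ⟨T, E, hb, hE, hCC, hη, hne, h14, -⟩ :=
    (kummerCoreχq p i j hj).exists_thetaKummerInput_etaleThetaData_prop14iii_ne_one
  exact ⟨ThetaSetting.modelχq_isEtThOrigin p i j hj, T, E, hb, hE ▸ hCC, hη, hne, h14⟩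

include i j hj in
/-- **Summary across the R78 cluster, under the guard**: for every prime `p` and all stage-2 exponents
`(i, j)` with `j` even there is a theta setting with `IsEtThOrigin` and Kummer data with NON-TRIVIAL `log(U)`
(abc-iut-w5-d171's `kummerDataχq_logU_ne_one`) carrying a genuine theta-Kummer input with `ConstCompat` and
`κΘ̈ ≠ 1` and an `EtaleThetaData` over THAT datum with `Prop14iiiKummer` — the Kummer block and the Prop. 1.4
(iii) Kummer-side hypotheses are jointly inhabited at one setting.
[cite: MochizukiEtTh2009, Prop 1.4 (iii) p.22] -/
theorem exists_isEtThOrigin_kummerData_logU_ne_one_and_prop14iiiKummer_genuine :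
    ∃ D : ThetaSetting p, D.IsEtThOrigin ∧ ∃ k : D.KummerData, k.logU ≠ 1 ∧
      ∃ (T : D.ThetaKummerInput) (E : D.EtaleThetaData),
        Function.Bijective T.coeff.hom ∧ E.toKummerData = k ∧ T.ConstCompat k ∧
        E.etaDd = T.kummerTheta ∧ T.kummerTheta ≠ 1 ∧ ThetaSetting.Prop14iiiKummer E T.kummerTheta := by
  obtain ⟨T, E, hb, hE, hCC, hη, hne, h14, -⟩ :=
    (kummerCoreχq p i j hj).exists_thetaKummerInput_etaleThetaData_prop14iii_ne_one
  exact ⟨ThetaSetting.modelχq p i j hj, ThetaSetting.modelχq_isEtThOrigin p i j hj, kummerDataχq p i j hj,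
    kummerDataχq_logU_ne_one p i j hj, T, E, hb, hE, hCC, hη, hne, h14⟩

end SettingModel

end Literature.AnabelianGeometry.EtaleTheta

end
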